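import Literature.AlgebraicGeometry.Motives.HyperbolicWeilType
import Literature.AlgebraicGeometry.HodgeTheory.ComplexGysin
import Literature.AlgebraicGeometry.HodgeTheory.MotivatedClasses
import Literature.AlgebraicTopology.SingularHomology.CupProductProofs
import HarnessLib

/-!
# The polarization pairing of a sum of pulled-back classes `f^*η + g^*κ` (block form on `H¹(X) ⊕ H¹(Y)`)

Layer `Literature/AlgebraicGeometry/Motives`, companion of `Motives/HyperbolicWeilType`
(`polarizationPairingOne X h j (x, y) = hʲ ⌣ (x ⌣ y)`, the polarization pairing in degree one).
Van Geemen's "the discriminant `det H` of a polarized abelian variety of Weil type is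
multiplicative under products" (LNM 1594, Lemma 5.2 (3); Markman, arXiv:2509.23403 §11.5 Step 2:
"The discriminant invariant … is multiplicative under cartesian products"), read through the
dictionary `Q_h = h^{2N-1} ⌣ (· ⌣ ·)` of `Motives/HyperbolicWeilType` (3), is the statement that
**the polarization pairing of a product polarization class `pr_X^* η + pr_Y^* κ` on
`H¹((X × Y)(ℂ); ℂ) ⊇ pr_X^* H¹(X) ⊕ pr_Y^* H¹(Y)` is the weighted orthogonal sum
`C(2N-1, g_X - 1)·(Q_η ⊗ κ^{g_Y}) ⊕ C(2N-1, g_X)·(η^{g_X} ⊗ Q_κ)`, the mixed pairings vanishing**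
(`g_X = dim X`, `g_Y = dim Y`, `2N = g_X + g_Y`; Birkenhake–Lange §5.3 for products of polarized
abelian varieties). This file PROVES the engine behind that statement for ARBITRARY `ℂ`-schemes
`X`, `Y` and morphisms `f : P ⟶ X`, `g : P ⟶ Y` from a third `ℂ`-scheme `P` (the product in the
application, file `Motives/HyperbolicWeilTypeProduct`):

* `lefschetzOperator_add_map_cupProduct` — one Lefschetz step:
  `L_{f^*η + g^*κ}(f^*α ⌣ g^*β) = f^*(η ⌣ α) ⌣ g^*β + f^*α ⌣ g^*(κ ⌣ β)` (associativity, naturality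
  and graded commutativity of `⌣`, all theorems of the tree);
* `lefschetzPow_add_map_cupProduct` — the closed form (binomial theorem for the two commuting
  Lefschetz operators): `L^m_{f^*η + g^*κ}(f^*α ⌣ g^*β) = Σ_{k+j=m} C(m,k) · f^*(L^k_η α) ⌣ g^*(L^j_κ β)`
  — stated with the cup product's free target degree, so that no degree transport is needed;
* `lefschetzPow_add_map_cupProduct_eq_single` / `…_eq_zero` — for `X`, `Y` smooth projective, all
  terms with `deg > 2 dim` vanish (`subsingleton_complexBetti`), so the sum collapses to at most one
  term;
* `polarizationPairingOne_add_map_map`, `…'`, `…_mixed`, `…_mixed'` — the three blocks of the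
  Gram matrix of `Q_{f^*η + g^*κ, m}`, `m = dim X + dim Y - 1`, on classes pulled back from the
  factors;
* degree-transport bookkeeping (`cupProduct_degCast_right`, `degCast_cupProduct`, `map_degCast`,
  `lefschetzPow_succ_one_eq_degCast`: `L^{j+1}_κ 1 = L^j_κ κ` up to transport) and the unit
  conversions `f^*x ⌣ f^*x' = f^*(x ⌣ x') ⌣ g^*1`, `g^*y ⌣ g^*y' = f^*1 ⌣ g^*(y ⌣ y')`.

Provenance: these theorems were first landed on the summit side (route `HeckePrymWeil` of the Hodge
summit, file `Theorems/HeckePrymWeilAimedDescendingProductLefschetz`, same statements and proofs);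
they are general facts about singular cohomology of complex points and are re-hosted here so that
Literature-level results (the partner-surface facts of `HodgeTheory/WeilClassesDescending`,
`HodgeTheory/WeilClassesFourfoldsFromSixfolds`, `Motives/AimedSplitProduct`) can use them.
Everything is proved; no definition and no named fact is introduced.

## References

* [vanGeemen1994HodgeAV] B. van Geemen, An introduction to the Hodge conjecture for abelian
  varieties, LNM 1594 (1994), Lemma 5.2 (2)–(3).
* [Markman2025SurveySecant] E. Markman, arXiv:2509.23403, §11.5 Step 2.
* [LangeBirkenhake1992] Ch. Birkenhake, H. Lange, Complex Abelian Varieties, Lemma 1.7.4 and §5.3.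
* [HatcherAT2002] A. Hatcher, Algebraic Topology (2002), Prop. 3.10, Thm. 3.11, §3.2 p. 211,
  Thm. 3.26 (c).
-/

noncomputable section

open CategoryTheory
open Literature.AlgebraicGeometry Literature.AlgebraicGeometry.HodgeTheory
open Literature.AlgebraicTopology.SingularHomology
open Literature.Geometry.Kaehler

namespace Literature.AlgebraicGeometry.Motives

variable {P X Y : Motives.SchemeOver ℂ} (f : P ⟶ X) (g : P ⟶ Y)

/-! ### Degree transport bookkeeping -/

/-- A degree transport on the right factor of a cup product is absorbed by the cup product's free
target degree. [folklore] -/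
theorem cupProduct_degCast_right {p a b n : ℕ} (h : a = b) (e : p + b = n) (x : complexBetti P p)
    (y : complexBetti P a) :
    cupProduct e x (complexBetti.degCast P h y) = cupProduct (by omega) x y := by
  subst h
  rfl

/-- A degree transport on the left factor of a cup product is absorbed by the cup product's free
target degree. [folklore] -/
theorem cupProduct_degCast_left {q a b n : ℕ} (h : a = b) (e : b + q = n) (x : complexBetti P a)
    (y : complexBetti P q) :
    cupProduct e (complexBetti.degCast P h x) y = cupProduct (by omega) x y := by
  subst h
  rfl

/-- A degree transport of a cup product is absorbed by the cup product's free target degree.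
[folklore] -/
theorem degCast_cupProduct {p q n n' : ℕ} (e : p + q = n) (h : n = n') (x : complexBetti P p)
    (y : complexBetti P q) :
    complexBetti.degCast P h (cupProduct e x y) = cupProduct (e.trans h) x y := by
  subst h
  rfl

/-- Pull-back commutes with degree transport. [folklore] -/
theorem map_degCast {a b : ℕ} (h : a = b) (y : complexBetti X a) :
    complexBetti.map f b (complexBetti.degCast X h y) = complexBetti.degCast P h (complexBetti.map f a y) := by
  subst h
  rfl

/-- **`L^{j+1}_κ 1 = L^j_κ κ`** (up to degree transport `2 + 2j = 0 + 2(j+1)`): the `(j+1)`-st power of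
the Lefschetz operator on the unit is the `j`-th power on the class itself (`κ ⌣ 1 = κ`, Hatcher
§3.2 p. 211). [cite: HatcherAT2002, §3.2 p. 211] -/
theorem lefschetzPow_succ_one_eq_degCast (κ : complexBetti X 2) (j : ℕ) :
    lefschetzPow κ (j + 1) 0 (singularCohomology.one ℂ (Motives.ComplexPoints X)) =
      complexBetti.degCast X (by omega) (lefschetzPow κ j 2 κ) := by
  induction j with
  | zero =>
    change cupProduct _ κ (singularCohomology.one ℂ (Motives.ComplexPoints X)) = _
    have h := cupProduct_one (R := ℂ) (X := Motives.ComplexPoints X) κ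
    exact h
  | succ j ih =>
    rw [lefschetzPow_succ, LinearMap.comp_apply, ih, lefschetzOperator_apply,
      cupProduct_degCast_right]
    conv_rhs => rw [lefschetzPow_succ, LinearMap.comp_apply, lefschetzOperator_apply,
      degCast_cupProduct]

/-! ### One Lefschetz step on a product class `f^*α ⌣ g^*β` -/

/-- `f^*η ⌣ (f^*α ⌣ g^*β) = f^*(η ⌣ α) ⌣ g^*β` (associativity and naturality of `⌣`; the target
degree `e` of `η ⌣ α` is free). [cite: HatcherAT2002, Prop. 3.10 and §3.2 p. 211] -/
theorem map_cupProduct_map_cupProduct_map {p q d d' e : ℕ} (hd : p + q = d) (hd' : 2 + d = d')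
    (he : 2 + p = e) (he' : e + q = d') (η : complexBetti X 2) (α : complexBetti X p)
    (β : complexBetti Y q) :
    cupProduct hd' (complexBetti.map f 2 η)
        (cupProduct hd (complexBetti.map f p α) (complexBetti.map g q β)) =
      cupProduct he' (complexBetti.map f e (cupProduct he η α)) (complexBetti.map g q β) := by
  rw [← cupProduct_assoc he hd he' hd', ← cupProduct_map]

/-- `g^*κ ⌣ (f^*α ⌣ g^*β) = f^*α ⌣ g^*(κ ⌣ β)` (associativity, naturality and graded commutativity
of `⌣`: the degree-`2` class `g^*κ` commutes with `f^*α`). [cite: HatcherAT2002, Prop. 3.10 and Thm. 3.11] -/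
theorem map_cupProduct_map_cupProduct_map' {p q d d' e : ℕ} (hd : p + q = d) (hd' : 2 + d = d')
    (he : 2 + q = e) (he' : p + e = d') (κ : complexBetti Y 2) (α : complexBetti X p)
    (β : complexBetti Y q) :
    cupProduct hd' (complexBetti.map g 2 κ)
        (cupProduct hd (complexBetti.map f p α) (complexBetti.map g q β)) =
      cupProduct he' (complexBetti.map f p α) (complexBetti.map g e (cupProduct he κ β)) := by
  have h1 : (2 + p) + q = d' := by omega
  have h2 : p + 2 = 2 + p := by omega
  rw [← cupProduct_assoc rfl hd h1 hd',
    cupProduct_gradedComm_holds (R := ℂ) (X := Motives.ComplexPoints P) rfl h2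
      (complexBetti.map g 2 κ) (complexBetti.map f p α),
    show ((-1 : ℂ) ^ (2 * p)) = 1 by rw [pow_mul, neg_one_sq, one_pow], one_smul,
    cupProduct_assoc h2 he h1 he', ← cupProduct_map]

/-- **One Lefschetz step** for the class `h = f^*η + g^*κ` on a product class:
`L_h(f^*α ⌣ g^*β) = f^*(η ⌣ α) ⌣ g^*β + f^*α ⌣ g^*(κ ⌣ β)`. [cite: HatcherAT2002, Prop. 3.10 and Thm. 3.11] -/
theorem lefschetzOperator_add_map_cupProduct {p q d d' e e' : ℕ} (hd : p + q = d)
    (hd' : 2 + d = d') (he : 2 + p = e) (he₁ : e + q = d') (he' : 2 + q = e') (he₂ : p + e' = d')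
    (η : complexBetti X 2) (κ : complexBetti Y 2) (α : complexBetti X p) (β : complexBetti Y q) :
    lefschetzOperator (complexBetti.map f 2 η + complexBetti.map g 2 κ) hd'
        (cupProduct hd (complexBetti.map f p α) (complexBetti.map g q β)) =
      cupProduct he₁ (complexBetti.map f e (cupProduct he η α)) (complexBetti.map g q β) +
        cupProduct he₂ (complexBetti.map f p α) (complexBetti.map g e' (cupProduct he' κ β)) := by
  rw [lefschetzOperator_apply, LinearMap.map_add₂, map_cupProduct_map_cupProduct_map f g hd hd' he he₁,
    map_cupProduct_map_cupProduct_map' f g hd hd' he' he₂]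

/-! ### The closed form: the binomial theorem for the two commuting Lefschetz operators -/

/-- **`L^m_{f^*η + g^*κ}(f^*α ⌣ g^*β) = Σ_{k+j=m} C(m,k) · f^*(L^k_η α) ⌣ g^*(L^j_κ β)`** — the
binomial theorem for the commuting operators `f^*η ⌣ ·` and `g^*κ ⌣ ·` on product classes (the
summand is written with a decidable guard `k + j = m` supplying the degree equation of the cup
product; on the antidiagonal the guard holds). [cite: HatcherAT2002, Prop. 3.10 and Thm. 3.11] -/
theorem lefschetzPow_add_map_cupProduct (m : ℕ) {p q D : ℕ} (hD : p + q = D) (η : complexBetti X 2)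
    (κ : complexBetti Y 2) (α : complexBetti X p) (β : complexBetti Y q) :
    lefschetzPow (complexBetti.map f 2 η + complexBetti.map g 2 κ) m D
        (cupProduct hD (complexBetti.map f p α) (complexBetti.map g q β)) =
      ∑ kj ∈ Finset.antidiagonal m, (m.choose kj.1 : ℂ) •
        (if h : kj.1 + kj.2 = m then
          cupProduct (by omega : (p + 2 * kj.1) + (q + 2 * kj.2) = D + 2 * m)
            (complexBetti.map f (p + 2 * kj.1) (lefschetzPow η kj.1 p α))
            (complexBetti.map g (q + 2 * kj.2) (lefschetzPow κ kj.2 q β))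
        else 0) := by
  induction m with
  | zero =>
    rw [Finset.Nat.antidiagonal_zero, Finset.sum_singleton]
    dsimp only
    rw [dif_pos (rfl : (0 : ℕ) + 0 = 0), Nat.choose_zero_right, Nat.cast_one, one_smul]
    rfl
  | succ m ih =>
    -- the level-`m+1` family
    set F : ℕ × ℕ → complexBetti P (D + 2 * (m + 1)) := fun kj =>
      if h : kj.1 + kj.2 = m + 1 then
        cupProduct (by omega : (p + 2 * kj.1) + (q + 2 * kj.2) = D + 2 * (m + 1))
          (complexBetti.map f (p + 2 * kj.1) (lefschetzPow η kj.1 p α))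
          (complexBetti.map g (q + 2 * kj.2) (lefschetzPow κ kj.2 q β))
      else 0 with hF
    -- one Lefschetz step on each level-`m` term
    have hstep : ∀ kj ∈ Finset.antidiagonal m,
        lefschetzOperator (complexBetti.map f 2 η + complexBetti.map g 2 κ)
            (by omega : 2 + (D + 2 * m) = D + 2 * (m + 1))
          (if h : kj.1 + kj.2 = m then
            cupProduct (by omega : (p + 2 * kj.1) + (q + 2 * kj.2) = D + 2 * m)
              (complexBetti.map f (p + 2 * kj.1) (lefschetzPow η kj.1 p α))
              (complexBetti.map g (q + 2 * kj.2) (lefschetzPow κ kj.2 q β))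
          else 0) = F (kj.1 + 1, kj.2) + F (kj.1, kj.2 + 1) := by
      intro kj hkj
      rw [Finset.mem_antidiagonal] at hkj
      rw [dif_pos hkj, hF]
      dsimp only
      rw [dif_pos (by omega), dif_pos (by omega),
        lefschetzOperator_add_map_cupProduct f g (by omega) (by omega)
          (by omega : 2 + (p + 2 * kj.1) = p + 2 * (kj.1 + 1)) (by omega)
          (by omega : 2 + (q + 2 * kj.2) = q + 2 * (kj.2 + 1)) (by omega)]
      rfl
    rw [lefschetzPow_succ, LinearMap.comp_apply, ih, map_sum]
    rw [Finset.sum_congr rfl fun kj hkj => by rw [map_smul, hstep kj hkj, smul_add],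
      Finset.sum_add_distrib]
    -- Pascal's rule on the antidiagonal
    have e1 := Finset.Nat.sum_antidiagonal_succ' (f := fun kj => (m.choose kj.1 : ℂ) • F kj) (n := m)
    have e2 := Finset.Nat.sum_antidiagonal_succ (f := fun kj => (m.choose kj.1 : ℂ) • F kj) (n := m)
    have e3 := Finset.Nat.sum_antidiagonal_succ (f := fun kj => ((m + 1).choose kj.1 : ℂ) • F kj)
      (n := m)
    simp only [Nat.choose_succ_self, Nat.cast_zero, zero_smul, zero_add] at e1
    simp only [Nat.choose_zero_right, Nat.cast_one, one_smul] at e2 e3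
    have key : ∑ kj ∈ Finset.antidiagonal m, (m.choose kj.1 : ℂ) • F (kj.1, kj.2 + 1) =
        F (0, m + 1) + ∑ kj ∈ Finset.antidiagonal m, (m.choose (kj.1 + 1) : ℂ) • F (kj.1 + 1, kj.2) :=
      e1.symm.trans e2
    change _ = ∑ kj ∈ Finset.antidiagonal (m + 1), ((m + 1).choose kj.1 : ℂ) • F kj
    rw [e3, key]
    simp only [Nat.choose_succ_succ', Nat.cast_add, add_smul, Finset.sum_add_distrib]
    abel

/-! ### Collapse of the sum for smooth projective `X`, `Y` (`Hᵏ = 0` for `k > 2 dim`) -/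

variable {nX nY : ℕ}

/-- A summand of the closed form whose `X`-degree exceeds `2 dim X` or whose `Y`-degree exceeds
`2 dim Y` vanishes (`subsingleton_complexBetti`, Hatcher Thm. 3.26 (c)). [cite: HatcherAT2002, §3.3 Thm. 3.26 (c)] -/
theorem summand_eq_zero_of_lt (hX : Motives.IsSmoothProjective nX X)
    (hY : Motives.IsSmoothProjective nY Y) {m p q D : ℕ} (hD : p + q = D) (η : complexBetti X 2)
    (κ : complexBetti Y 2) (α : complexBetti X p) (β : complexBetti Y q) {kj : ℕ × ℕ}
    (hlt : 2 * nX < p + 2 * kj.1 ∨ 2 * nY < q + 2 * kj.2) :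
    (if h : kj.1 + kj.2 = m then
        cupProduct (by omega : (p + 2 * kj.1) + (q + 2 * kj.2) = D + 2 * m)
          (complexBetti.map f (p + 2 * kj.1) (lefschetzPow η kj.1 p α))
          (complexBetti.map g (q + 2 * kj.2) (lefschetzPow κ kj.2 q β))
      else 0) = 0 := by
  split_ifs with hm
  · rcases hlt with hlt | hlt
    · haveI := subsingleton_complexBetti hX hlt
      rw [Subsingleton.elim (lefschetzPow η kj.1 p α) 0, map_zero, LinearMap.map_zero₂]
    · haveI := subsingleton_complexBetti hY hlt
      rw [Subsingleton.elim (lefschetzPow κ kj.2 q β) 0, map_zero, map_zero]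
  · rfl

/-- **All terms vanish**: if every `(k, j)` with `k + j = m` has `p + 2k > 2 dim X` or
`q + 2j > 2 dim Y`, then `L^m_{f^*η + g^*κ}(f^*α ⌣ g^*β) = 0`. [cite: HatcherAT2002, §3.3 Thm. 3.26 (c)] -/
theorem lefschetzPow_add_map_cupProduct_eq_zero (hX : Motives.IsSmoothProjective nX X)
    (hY : Motives.IsSmoothProjective nY Y) (m : ℕ) {p q D : ℕ} (hD : p + q = D)
    (η : complexBetti X 2) (κ : complexBetti Y 2) (α : complexBetti X p) (β : complexBetti Y q)
    (hlt : ∀ kj ∈ Finset.antidiagonal m, 2 * nX < p + 2 * kj.1 ∨ 2 * nY < q + 2 * kj.2) :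
    lefschetzPow (complexBetti.map f 2 η + complexBetti.map g 2 κ) m D
        (cupProduct hD (complexBetti.map f p α) (complexBetti.map g q β)) = 0 := by
  rw [lefschetzPow_add_map_cupProduct]
  exact Finset.sum_eq_zero fun kj hkj => by
    rw [summand_eq_zero_of_lt f g hX hY hD η κ α β (hlt kj hkj), smul_zero]

/-- **One term survives**: if `k₀ + j₀ = m` with `p + 2k₀ ≥ 2 dim X - 1` and `q + 2j₀ ≥ 2 dim Y - 1`,
then every other term of the closed form vanishes and
`L^m_{f^*η + g^*κ}(f^*α ⌣ g^*β) = C(m, k₀) · f^*(L^{k₀}_η α) ⌣ g^*(L^{j₀}_κ β)`. [cite: HatcherAT2002, §3.3 Thm. 3.26 (c)] -/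
theorem lefschetzPow_add_map_cupProduct_eq_single (hX : Motives.IsSmoothProjective nX X)
    (hY : Motives.IsSmoothProjective nY Y) (m : ℕ) {p q D : ℕ} (hD : p + q = D)
    (η : complexBetti X 2) (κ : complexBetti Y 2) (α : complexBetti X p) (β : complexBetti Y q)
    (k₀ j₀ : ℕ) (h₀ : k₀ + j₀ = m) (hk₀ : 2 * nX ≤ p + 2 * k₀ + 1) (hj₀ : 2 * nY ≤ q + 2 * j₀ + 1) :
    lefschetzPow (complexBetti.map f 2 η + complexBetti.map g 2 κ) m D
        (cupProduct hD (complexBetti.map f p α) (complexBetti.map g q β)) =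
      (m.choose k₀ : ℂ) • cupProduct (by omega : (p + 2 * k₀) + (q + 2 * j₀) = D + 2 * m)
        (complexBetti.map f (p + 2 * k₀) (lefschetzPow η k₀ p α))
        (complexBetti.map g (q + 2 * j₀) (lefschetzPow κ j₀ q β)) := by
  rw [lefschetzPow_add_map_cupProduct, Finset.sum_eq_single (k₀, j₀)]
  · dsimp only
    rw [dif_pos h₀]
  · intro kj hkj hne
    rw [Finset.mem_antidiagonal] at hkj
    have hne' : kj.1 ≠ k₀ ∨ kj.2 ≠ j₀ := by
      rwa [Ne, Prod.ext_iff, not_and_or] at hne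
    rw [summand_eq_zero_of_lt f g hX hY hD η κ α β (by omega), smul_zero]
  · intro hnot
    exact absurd (Finset.mem_antidiagonal.2 h₀) hnot

/-! ### Unit conversions: classes pulled back from one factor as product classes -/

/-- `f^*x ⌣ f^*x' = f^*(x ⌣ x') ⌣ g^*1`. [cite: HatcherAT2002, Prop. 3.10 and §3.2 p. 211] -/
theorem cupProduct_map_map_eq_cupProduct_map_one {p p' d : ℕ} (h : p + p' = d)
    (x : complexBetti X p) (x' : complexBetti X p') :
    cupProduct h (complexBetti.map f p x) (complexBetti.map f p' x') =
      cupProduct (Nat.add_zero d) (complexBetti.map f d (cupProduct h x x'))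
        (complexBetti.map g 0 (singularCohomology.one ℂ (Motives.ComplexPoints Y))) := by
  rw [← cupProduct_map]
  change _ = cupProduct _ _ (singularCohomology.map ℂ ℂ _ 0 (singularCohomology.one ℂ _))
  rw [singularCohomology.map_one, cupProduct_one]

/-- `g^*y ⌣ g^*y' = f^*1 ⌣ g^*(y ⌣ y')`. [cite: HatcherAT2002, Prop. 3.10 and §3.2 p. 211] -/
theorem cupProduct_map_map_eq_cupProduct_one_map {q q' d : ℕ} (h : q + q' = d)
    (y : complexBetti Y q) (y' : complexBetti Y q') :
    cupProduct h (complexBetti.map g q y) (complexBetti.map g q' y') =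
      cupProduct (Nat.zero_add d) (complexBetti.map f 0 (singularCohomology.one ℂ (Motives.ComplexPoints X)))
        (complexBetti.map g d (cupProduct h y y')) := by
  rw [← cupProduct_map]
  change _ = cupProduct _ (singularCohomology.map ℂ ℂ _ 0 (singularCohomology.one ℂ _)) _
  rw [singularCohomology.map_one, one_cupProduct]

/-! ### The polarization pairing of `f^*η + g^*κ` on classes pulled back from the factors -/

section Pairing

variable {jX jY : ℕ} (hX : Motives.IsSmoothProjective (jX + 1) X) (hY : Motives.IsSmoothProjective (jY + 1) Y)
  (η : complexBetti X 2) (κ : complexBetti Y 2) {m : ℕ} (hm : m = jX + jY + 1)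

include hX hY hm

/-- **The `X`–`X` block**: for `x, x' ∈ H¹(X(ℂ))`,
`Q_{f^*η + g^*κ, m}(f^*x, f^*x') = C(m, jX) · f^*(Q_{η, jX}(x, x')) ⌣ g^*(L^{jY}_κ κ)`
(`dim X = jX + 1`, `dim Y = jY + 1`, `m = jX + jY + 1 = dim X + dim Y - 1`): the only surviving term
of the binomial expansion has exactly `dim Y` factors `g^*κ`. Van Geemen's multiplicativity of the
discriminant under products (LNM 1594, Lemma 5.2 (3)), cohomological form.
[cite: vanGeemen1994HodgeAV, Lemma 5.2 (2)–(3)] -/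
theorem polarizationPairingOne_add_map_map (x x' : complexBetti X 1) :
    Motives.polarizationPairingOne P (complexBetti.map f 2 η + complexBetti.map g 2 κ) m
        (complexBetti.map f 1 x) (complexBetti.map f 1 x') =
      (m.choose jX : ℂ) • cupProduct (by omega : (2 + 2 * jX) + (2 + 2 * jY) = 2 + 2 * m)
        (complexBetti.map f (2 + 2 * jX) (Motives.polarizationPairingOne X η jX x x'))
        (complexBetti.map g (2 + 2 * jY) (lefschetzPow κ jY 2 κ)) := by
  rw [Motives.polarizationPairingOne_apply, cupProduct_map_map_eq_cupProduct_map_one f g,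
    lefschetzPow_add_map_cupProduct_eq_single f g hX hY m (Nat.add_zero 2) η κ _ _ jX (jY + 1)
      (by omega) (by omega) (by omega),
    lefschetzPow_succ_one_eq_degCast, map_degCast, cupProduct_degCast_right]
  rfl

/-- **The `Y`–`Y` block**: for `y, y' ∈ H¹(Y(ℂ))`,
`Q_{f^*η + g^*κ, m}(g^*y, g^*y') = C(m, jX + 1) · f^*(L^{jX}_η η) ⌣ g^*(Q_{κ, jY}(y, y'))`: the only
surviving term has exactly `dim X` factors `f^*η`. [cite: vanGeemen1994HodgeAV, Lemma 5.2 (2)–(3)] -/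
theorem polarizationPairingOne_add_map_map' (y y' : complexBetti Y 1) :
    Motives.polarizationPairingOne P (complexBetti.map f 2 η + complexBetti.map g 2 κ) m
        (complexBetti.map g 1 y) (complexBetti.map g 1 y') =
      (m.choose (jX + 1) : ℂ) • cupProduct (by omega : (2 + 2 * jX) + (2 + 2 * jY) = 2 + 2 * m)
        (complexBetti.map f (2 + 2 * jX) (lefschetzPow η jX 2 η))
        (complexBetti.map g (2 + 2 * jY) (Motives.polarizationPairingOne Y κ jY y y')) := by
  rw [Motives.polarizationPairingOne_apply, cupProduct_map_map_eq_cupProduct_one_map f g,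
    lefschetzPow_add_map_cupProduct_eq_single f g hX hY m (Nat.zero_add 2) η κ _ _ (jX + 1) jY
      (by omega) (by omega) (by omega),
    lefschetzPow_succ_one_eq_degCast, map_degCast, cupProduct_degCast_left]
  rfl

/-- **The mixed pairings vanish**: `Q_{f^*η + g^*κ, m}(f^*x, g^*y) = 0` for `x ∈ H¹(X(ℂ))`,
`y ∈ H¹(Y(ℂ))` — every term of the binomial expansion has odd `X`-degree `> 2 dim X` or odd
`Y`-degree `> 2 dim Y`. [cite: vanGeemen1994HodgeAV, Lemma 5.2 (2)–(3)] -/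
theorem polarizationPairingOne_add_map_map_mixed (x : complexBetti X 1) (y : complexBetti Y 1) :
    Motives.polarizationPairingOne P (complexBetti.map f 2 η + complexBetti.map g 2 κ) m
        (complexBetti.map f 1 x) (complexBetti.map g 1 y) = 0 := by
  rw [Motives.polarizationPairingOne_apply]
  exact lefschetzPow_add_map_cupProduct_eq_zero f g hX hY m rfl η κ x y fun kj hkj => by
    rw [Finset.mem_antidiagonal] at hkj
    omega

/-- The mixed pairings vanish in the other order too: `Q_{f^*η + g^*κ, m}(g^*y, f^*x) = 0` (graded
commutativity). [cite: vanGeemen1994HodgeAV, Lemma 5.2 (2)–(3)] -/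
theorem polarizationPairingOne_add_map_map_mixed' (x : complexBetti X 1) (y : complexBetti Y 1) :
    Motives.polarizationPairingOne P (complexBetti.map f 2 η + complexBetti.map g 2 κ) m
        (complexBetti.map g 1 y) (complexBetti.map f 1 x) = 0 := by
  rw [Motives.polarizationPairingOne_apply,
    cupProduct_gradedComm_holds (R := ℂ) (X := Motives.ComplexPoints P) rfl rfl
      (complexBetti.map g 1 y) (complexBetti.map f 1 x), map_smul,
    ← Motives.polarizationPairingOne_apply, polarizationPairingOne_add_map_map_mixed f g hX hY η κ hm,
    smul_zero]

end Pairing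

end Literature.AlgebraicGeometry.Motives

end
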